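import Mathlib.Analysis.Calculus.MeanValue
import Mathlib.Analysis.SpecialFunctions.ExpDeriv
import Mathlib.Analysis.SpecialFunctions.Log.ENNRealLog
import Mathlib.MeasureTheory.Integral.IntervalIntegral.FundThmCalculus
import Mathlib.MeasureTheory.Integral.DominatedConvergence
import HarnessLib

/-!
# Non-modal optimal energy amplification of a linear evolution given as a solution predicate

Topic `Literature/Analysis/FluidPDE` (definition item `defn-optimalAmplification`, wanted by route
`AnnealedZeroHorizon` of `AtomisticToContinuum/HydrodynamicLimit`, item `OnsetLawR`
`stmt-AtomisticToContinuum-13797`; companion file `ChuEnergy.lean` supplies the energy functional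
of compressible perturbations that is fed to the present definition).

**The notion.** For a linear initial-value problem `q̇ = L(t) q` with propagator
`q(t₁) = Φ(t₁, t₀) q(t₀)` and an energy (squared norm) `E = ‖·‖²_E`, the *maximum possible
amplification of initial energy* between `t₀` and `t₁` is

`G(t₁; t₀) = max_{q(t₀) ≠ 0} ‖q(t₁)‖²_E / ‖q(t₀)‖²_E = ‖Φ(t₁, t₀)‖²_E`,

the squared propagator norm, optimised over ALL initial conditions (non-modal / transient growth,
as opposed to the growth `e^{2 ω_i (t₁ - t₀)}` of the least stable eigenmode): Schmid–Henningson
2001, §4.4 (growth function `G(t)`); Trefethen–Embree 2005, §20 (plane Couette flow: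
`‖e^{tL}‖ ≈ R/29.1`, "in this [energy] measure the amplification factor … is 14,400", PDF text at
Fig. 20.5); for compressible flows with the Chu/Mack energy norm: Hanifi–Schmid–Henningson 1996,
§III, restated as eq. (6) of Dwivedi et al. 2020,
`G(t) = max_{q(0) ≠ 0} ‖q(t)‖²_E / ‖q(0)‖²_E` (PDF p. 4).

**The formalisation** (`optimalAmplification IsSol E t₀ t₁ : ℝ≥0∞`). The requesting route has no
semigroup object: its linear evolutions (linearised hard-sphere Euler / Navier–Stokes–Fourier
around a prescribed, time-dependent background, `IsLinearizedHsEulerSolution …`) are SOLUTION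
PREDICATES on trajectories `V : ℝ → X` (`X = 𝕋^d → State`). We therefore define `G` directly as
the supremum, over all trajectories `V` satisfying the predicate and having positive initial
energy, of the ratio `E t₁ (V t₁) / E t₀ (V t₀)`, valued in `ℝ≥0∞` so that neither existence nor
uniqueness nor energy bounds are presupposed (no well-posedness needed: non-uniqueness only
enlarges the supremum, an ill-posed problem may have `G = ∞`). The energy may depend on time
(`E : ℝ → X → ℝ`): the Chu weights of a perturbation of a time-dependent background do.

## Main definitions and results

* `optimalAmplification IsSol E t₀ t₁` — the optimal amplification `G(t₁; t₀)`.
* `ofReal_div_le_optimalAmplification` — every admissible solution realises a lower bound;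
  `optimalAmplification_le_iff` — `G ≤ c` iff every admissible ratio is `≤ c`;
  `optimalAmplification_mono` — monotone in the solution set;
  `one_le_optimalAmplification_of_le` / `…_of_conserved` — `G ≥ 1` as soon as one admissible
  solution does not lose (e.g. conserves) energy; `optimalAmplification_self` — `G(t₀; t₀) = 1`.
* ENERGY BOUND: `optimalAmplification_le_ofReal` (if `E(t₁) ≤ C·E(t₀)` along every solution then
  `G ≤ C`), the Grönwall lemma `le_exp_mul_of_deriv_right_le` (`ė ≤ 2λe` with `λ = Λ̇` gives
  `e(t₁) ≤ e^{2(Λ(t₁)−Λ(t₀))} e(t₀)`), and its consequences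
  `optimalAmplification_le_exp_of_deriv_right_le` (`G ≤ e^{2(Λ(t₁)−Λ(t₀))}`),
  `log_optimalAmplification_le` (`log G ≤ 2(Λ(t₁)−Λ(t₀))` in `EReal`),
  `optimalAmplification_le_exp_integral` (`λ` continuous on `[t₀, t₁]`: `G ≤ e^{2∫λ}`) and
  `optimalAmplification_le_exp_const` (constant rate). This is the abstract form of the
  Reynolds-stress production bound `dE/dt ≤ max|∂₂U_b| · E` for parallel shear backgrounds
  (Schmid–Henningson 2001, §4.2; the modal analogue for compressible shear layers is Chimonas 1970).

## Design choices and what is NOT here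

* Junk values: if no trajectory satisfies `IsSol` with `0 < E t₀ (V t₀)`, the supremum is empty
  and `G = 0` (in the literature `G(t₀; t₀) = 1` always; here `optimalAmplification_self` needs one
  admissible trajectory). Trajectories with non-positive initial energy are not admissible
  (for the positive-definite energies of the literature this is `q(t₀) ≠ 0`); negative ratios are
  truncated to `0` by `ENNReal.ofReal` and never occur for non-negative energies.
* `IsSol` is arbitrary: linearity of the evolution is not assumed (for a linear predicate and a
  quadratic `E`, `G` is also the supremum over unit initial energy — not needed, not proved).
* NOT here: the variational / adjoint characterisation of optimal perturbations (SVD of the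
  propagator, direct–adjoint iteration), `G_max = sup_t G(t)`, and any statement about a specific
  flow; the Chu energy lives in `ChuEnergy.lean`.

## References

* P. J. Schmid, D. S. Henningson, *Stability and Transition in Shear Flows*, Applied Mathematical
  Sciences 142, Springer 2001, §§4.2–4.4 (energy evolution, Reynolds–Orr equation, the growth
  function `G(t) = max ‖q(t)‖²/‖q₀‖²`).
* L. N. Trefethen, M. Embree, *Spectra and Pseudospectra*, Princeton 2005, §20 (transient growth
  `‖e^{tL}‖` for plane Couette / Poiseuille flow, energy amplification as its square).
* A. Hanifi, P. J. Schmid, D. S. Henningson, *Transient growth in compressible boundary layer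
  flow*, Phys. Fluids 8 (1996) 826–837, §§II–III.
* A. Dwivedi, N. Hildebrand, J. W. Nichols, G. V. Candler, M. R. Jovanović, *Transient growth
  analysis of oblique shock-wave/boundary-layer interactions at Mach 5.92*, Phys. Rev. Fluids 5
  (2020) 063904, eqs. (5)–(6) (arXiv:1901.09132, PDF p. 4).
* G. Chimonas, *The extension of the Miles–Howard theorem to compressible fluids*, J. Fluid
  Mech. 43 (1970) 833–836.
-/

noncomputable section

open MeasureTheory Set Filter
open _root_.Topology
open scoped ENNReal

namespace Literature.Analysis.FluidPDE

variable {X : Type*}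

/-! ### The optimal amplification -/

/-- **Optimal (non-modal) energy amplification** `G(t₁; t₀)` of the evolution described by the
solution predicate `IsSol` on trajectories `V : ℝ → X`, measured in the (possibly time-dependent)
energy `E : ℝ → X → ℝ`: the supremum over all trajectories satisfying `IsSol` with positive
initial energy `0 < E t₀ (V t₀)` of the ratio `E t₁ (V t₁) / E t₀ (V t₀)`, in `ℝ≥0∞`
(`= ‖Φ(t₁,t₀)‖²_E`, the squared energy norm of the propagator, when the problem is well posed;
`0` if no admissible trajectory exists). Schmid–Henningson's growth function
`G(t) = max_{q₀ ≠ 0} ‖q(t)‖²_E/‖q₀‖²_E`; for compressible flow in the Chu/Mack energy norm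
Hanifi–Schmid–Henningson 1996 §III, Dwivedi et al. 2020 eq. (6).
[cite: SchmidHenningson2001, §4.4 (growth function G(t)); HanifiSchmidHenningson1996 §III; DwivediEtAl2020 eq. (6) (arXiv:1901.09132, p. 4); TrefethenEmbree2005 §20] -/
def optimalAmplification (IsSol : (ℝ → X) → Prop) (E : ℝ → X → ℝ) (t₀ t₁ : ℝ) : ℝ≥0∞ :=
  ⨆ (V : ℝ → X) (_ : IsSol V ∧ 0 < E t₀ (V t₀)), ENNReal.ofReal (E t₁ (V t₁) / E t₀ (V t₀))

variable {IsSol IsSol' : (ℝ → X) → Prop} {E : ℝ → X → ℝ} {t₀ t₁ : ℝ}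

/-- Every admissible trajectory bounds the optimal amplification from below by its own energy
ratio (`G` is a maximum over initial conditions). [cite: SchmidHenningson2001, §4.4] -/
theorem ofReal_div_le_optimalAmplification {V : ℝ → X} (hV : IsSol V) (hE : 0 < E t₀ (V t₀)) :
    ENNReal.ofReal (E t₁ (V t₁) / E t₀ (V t₀)) ≤ optimalAmplification IsSol E t₀ t₁ :=
  le_iSup₂ (f := fun (V : ℝ → X) (_ : IsSol V ∧ 0 < E t₀ (V t₀)) =>
    ENNReal.ofReal (E t₁ (V t₁) / E t₀ (V t₀))) V ⟨hV, hE⟩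

/-- `G(t₁; t₀) ≤ c` iff the energy ratio of every admissible trajectory is `≤ c`. [folklore] -/
theorem optimalAmplification_le_iff {c : ℝ≥0∞} :
    optimalAmplification IsSol E t₀ t₁ ≤ c ↔
      ∀ V, IsSol V → 0 < E t₀ (V t₀) → ENNReal.ofReal (E t₁ (V t₁) / E t₀ (V t₀)) ≤ c := by
  simp only [optimalAmplification, iSup_le_iff, and_imp]

/-- The optimal amplification is monotone in the solution set: enlarging the class of admissible
trajectories can only increase `G`. [folklore] -/
theorem optimalAmplification_mono (h : ∀ V, IsSol V → IsSol' V) :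
    optimalAmplification IsSol E t₀ t₁ ≤ optimalAmplification IsSol' E t₀ t₁ :=
  optimalAmplification_le_iff.2 fun _ hV hE => ofReal_div_le_optimalAmplification (h _ hV) hE

/-- Junk value: with no admissible trajectory (none satisfies `IsSol` with positive initial
energy) the optimal amplification is `0`. [folklore] -/
theorem optimalAmplification_eq_zero (h : ∀ V, IsSol V → E t₀ (V t₀) ≤ 0) :
    optimalAmplification IsSol E t₀ t₁ = 0 :=
  le_antisymm (optimalAmplification_le_iff.2 fun V hV hE => absurd (h V hV) (not_le.2 hE)) bot_le

/-- If one admissible trajectory does not lose energy between `t₀` and `t₁`, then `G(t₁; t₀) ≥ 1`.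
[folklore] -/
theorem one_le_optimalAmplification_of_le {V : ℝ → X} (hV : IsSol V) (hE : 0 < E t₀ (V t₀))
    (h : E t₀ (V t₀) ≤ E t₁ (V t₁)) : 1 ≤ optimalAmplification IsSol E t₀ t₁ := by
  refine le_trans ?_ (ofReal_div_le_optimalAmplification hV hE)
  rw [← ENNReal.ofReal_one]
  exact ENNReal.ofReal_le_ofReal ((one_le_div hE).2 h)

/-- If one admissible trajectory conserves energy between `t₀` and `t₁` (e.g. the linearised
inviscid system around a uniform state, in the Chu energy), then `G(t₁; t₀) ≥ 1`. [folklore] -/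
theorem one_le_optimalAmplification_of_conserved {V : ℝ → X} (hV : IsSol V) (hE : 0 < E t₀ (V t₀))
    (h : E t₁ (V t₁) = E t₀ (V t₀)) : 1 ≤ optimalAmplification IsSol E t₀ t₁ :=
  one_le_optimalAmplification_of_le hV hE h.ge

/-- `G(t₀; t₀) = 1` as soon as one admissible trajectory exists. [cite: SchmidHenningson2001, §4.4] -/
theorem optimalAmplification_self (h : ∃ V, IsSol V ∧ 0 < E t₀ (V t₀)) :
    optimalAmplification IsSol E t₀ t₀ = 1 := by
  obtain ⟨V, hV, hE⟩ := h
  refine le_antisymm (optimalAmplification_le_iff.2 fun W _ hW => ?_)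
    (one_le_optimalAmplification_of_le hV hE le_rfl)
  rw [div_self hW.ne', ENNReal.ofReal_one]

/-! ### Energy bounds -/

/-- **Energy bound, abstract form.** If along every admissible trajectory the final energy is at
most `C` times the initial energy, then `G(t₁; t₀) ≤ C`. [folklore] -/
theorem optimalAmplification_le_ofReal {C : ℝ}
    (h : ∀ V, IsSol V → 0 < E t₀ (V t₀) → E t₁ (V t₁) ≤ C * E t₀ (V t₀)) :
    optimalAmplification IsSol E t₀ t₁ ≤ ENNReal.ofReal C :=
  optimalAmplification_le_iff.2 fun V hV hE =>
    ENNReal.ofReal_le_ofReal ((div_le_iff₀ hE).2 (h V hV hE))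

/-- **Grönwall's lemma for a linear differential inequality with time-dependent rate** (one-sided
derivatives, the form of Mathlib's `norm_le_gronwallBound_of_norm_deriv_right_le` but with a
variable coefficient): if `e` and `Λ` are continuous on `[a, b]`, right-differentiable on `[a, b)`
with `ė(t) ≤ 2 Λ̇(t) e(t)`, then `e(b) ≤ exp(2(Λ(b) − Λ(a))) · e(a)`. Proof: the gauged energy
`exp(−2(Λ − Λ(a))) e` has non-positive right derivative. [folklore] -/
theorem le_exp_mul_of_deriv_right_le {e e' Λ l : ℝ → ℝ} {a b : ℝ} (hab : a ≤ b)
    (he : ContinuousOn e (Icc a b)) (hΛ : ContinuousOn Λ (Icc a b))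
    (he' : ∀ t ∈ Ico a b, HasDerivWithinAt e (e' t) (Ici t) t)
    (hΛ' : ∀ t ∈ Ico a b, HasDerivWithinAt Λ (l t) (Ici t) t)
    (bound : ∀ t ∈ Ico a b, e' t ≤ 2 * l t * e t) :
    e b ≤ Real.exp (2 * (Λ b - Λ a)) * e a := by
  set g : ℝ → ℝ := fun t => Real.exp (-(2 * (Λ t - Λ a))) * e t with hg
  have hgc : ContinuousOn g (Icc a b) :=
    ((hΛ.sub continuousOn_const).const_smul (2 : ℝ)).neg.rexp.mul he
  have hg' : ∀ t ∈ Ico a b,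
      HasDerivWithinAt g (Real.exp (-(2 * (Λ t - Λ a))) * (e' t - 2 * l t * e t)) (Ici t) t := by
    intro t ht
    have h1 : HasDerivWithinAt (fun s => -(2 * (Λ s - Λ a))) (-(2 * l t)) (Ici t) t :=
      (((hΛ' t ht).sub_const (Λ a)).const_mul (2 : ℝ)).neg
    exact (h1.exp.mul (he' t ht)).congr_deriv (by ring)
  have key := image_le_of_deriv_right_le_deriv_boundary hgc hg' (B := fun _ => g a)
    (B' := fun _ => 0) le_rfl continuousOn_const (fun t _ => hasDerivWithinAt_const _ _ _)
    (fun t ht => mul_nonpos_of_nonneg_of_nonpos (Real.exp_pos _).le (sub_nonpos.2 (bound t ht)))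
    (right_mem_Icc.2 hab)
  have hga : g a = e a := by simp [hg]
  have hgb : e b = Real.exp (2 * (Λ b - Λ a)) * g b := by
    simp only [hg]
    rw [← mul_assoc, ← Real.exp_add, add_neg_cancel, Real.exp_zero, one_mul]
  rw [hgb, ← hga]
  exact mul_le_mul_of_nonneg_left key (Real.exp_pos _).le

/-- **Energy bound, Grönwall form.** If `Λ` is continuous on `[t₀, t₁]` with right derivative
`λ`, and along every admissible trajectory the energy `t ↦ E t (V t)` is continuous on
`[t₀, t₁]`, right-differentiable on `[t₀, t₁)` with `d/dt E ≤ 2 λ(t) E`, then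
`G(t₁; t₀) ≤ exp(2(Λ(t₁) − Λ(t₀)))`. With `λ(t) = ½ max_x |∂₂U_b(t, x)|` this is the
Reynolds-stress production bound for a parallel shear background (Schmid–Henningson §4.2).
[folklore] -/
theorem optimalAmplification_le_exp_of_deriv_right_le {e' : (ℝ → X) → ℝ → ℝ} {Λ l : ℝ → ℝ}
    (ht : t₀ ≤ t₁) (hΛ : ContinuousOn Λ (Icc t₀ t₁))
    (hΛ' : ∀ t ∈ Ico t₀ t₁, HasDerivWithinAt Λ (l t) (Ici t) t)
    (he : ∀ V, IsSol V → ContinuousOn (fun t => E t (V t)) (Icc t₀ t₁))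
    (he' : ∀ V, IsSol V → ∀ t ∈ Ico t₀ t₁, HasDerivWithinAt (fun s => E s (V s)) (e' V t) (Ici t) t)
    (bound : ∀ V, IsSol V → ∀ t ∈ Ico t₀ t₁, e' V t ≤ 2 * l t * E t (V t)) :
    optimalAmplification IsSol E t₀ t₁ ≤ ENNReal.ofReal (Real.exp (2 * (Λ t₁ - Λ t₀))) :=
  optimalAmplification_le_ofReal fun V hV _ =>
    le_exp_mul_of_deriv_right_le ht (he V hV) hΛ (he' V hV) hΛ' (bound V hV)

/-- **Energy bound, logarithmic form:** under the hypotheses of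
`optimalAmplification_le_exp_of_deriv_right_le`, `log G(t₁; t₀) ≤ 2(Λ(t₁) − Λ(t₀))`
(`ENNReal.log`, valued in `EReal`; `log 0 = ⊥`). [folklore] -/
theorem log_optimalAmplification_le {e' : (ℝ → X) → ℝ → ℝ} {Λ l : ℝ → ℝ}
    (ht : t₀ ≤ t₁) (hΛ : ContinuousOn Λ (Icc t₀ t₁))
    (hΛ' : ∀ t ∈ Ico t₀ t₁, HasDerivWithinAt Λ (l t) (Ici t) t)
    (he : ∀ V, IsSol V → ContinuousOn (fun t => E t (V t)) (Icc t₀ t₁))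
    (he' : ∀ V, IsSol V → ∀ t ∈ Ico t₀ t₁, HasDerivWithinAt (fun s => E s (V s)) (e' V t) (Ici t) t)
    (bound : ∀ V, IsSol V → ∀ t ∈ Ico t₀ t₁, e' V t ≤ 2 * l t * E t (V t)) :
    (optimalAmplification IsSol E t₀ t₁).log ≤ ((2 * (Λ t₁ - Λ t₀) : ℝ) : EReal) := by
  have h := ENNReal.log_monotone
    (optimalAmplification_le_exp_of_deriv_right_le ht hΛ hΛ' he he' bound)
  rwa [ENNReal.log_ofReal_of_pos (Real.exp_pos _), Real.log_exp] at h

/-- **Energy bound with an integrable rate.** If `λ` is continuous on `[t₀, t₁]` and along every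
admissible trajectory `d/dt E ≤ 2 λ(t) E` (right derivatives on `[t₀, t₁)`, energy continuous on
`[t₀, t₁]`), then `G(t₁; t₀) ≤ exp(2 ∫_{t₀}^{t₁} λ)`. [folklore] -/
theorem optimalAmplification_le_exp_integral {e' : (ℝ → X) → ℝ → ℝ} {l : ℝ → ℝ}
    (ht : t₀ ≤ t₁) (hl : ContinuousOn l (Icc t₀ t₁))
    (he : ∀ V, IsSol V → ContinuousOn (fun t => E t (V t)) (Icc t₀ t₁))
    (he' : ∀ V, IsSol V → ∀ t ∈ Ico t₀ t₁, HasDerivWithinAt (fun s => E s (V s)) (e' V t) (Ici t) t)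
    (bound : ∀ V, IsSol V → ∀ t ∈ Ico t₀ t₁, e' V t ≤ 2 * l t * E t (V t)) :
    optimalAmplification IsSol E t₀ t₁ ≤
      ENNReal.ofReal (Real.exp (2 * ∫ t in t₀..t₁, l t)) := by
  -- the primitive `Λ t = ∫_{t₀}^{t} λ`
  set Λ : ℝ → ℝ := fun t => ∫ s in t₀..t, l s with hΛdef
  have hli : IntervalIntegrable l volume t₀ t₁ := hl.intervalIntegrable_of_Icc ht
  have hlint : IntegrableOn l (uIcc t₀ t₁) volume := by
    rw [uIcc_of_le ht]
    exact hl.integrableOn_compact isCompact_Icc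
  have hΛc : ContinuousOn Λ (Icc t₀ t₁) := by
    have := intervalIntegral.continuousOn_primitive_interval (μ := volume) hlint
    rwa [uIcc_of_le ht] at this
  have hΛd : ∀ t ∈ Ico t₀ t₁, HasDerivWithinAt Λ (l t) (Ici t) t := by
    intro t ht'
    have hIcc : Icc t₀ t₁ ∈ 𝓝[>] t :=
      mem_of_superset (Icc_mem_nhdsGT ht'.2) (Icc_subset_Icc ht'.1 le_rfl)
    have hmeas : StronglyMeasurableAtFilter l (𝓝[>] t) volume :=
      (hl.stronglyMeasurableAtFilter_nhdsWithin measurableSet_Icc t).filter_mono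
        (nhdsWithin_le_iff.2 hIcc)
    have hcont : ContinuousWithinAt l (Ioi t) t :=
      (hl t ⟨ht'.1, ht'.2.le⟩).mono_of_mem_nhdsWithin hIcc
    exact intervalIntegral.integral_hasDerivWithinAt_right (hli.mono_set (by
      rw [uIcc_of_le ht, uIcc_of_le ht'.1]; exact Icc_subset_Icc le_rfl ht'.2.le)) hmeas hcont
  have h := optimalAmplification_le_exp_of_deriv_right_le ht hΛc hΛd he he' bound
  have h0 : Λ t₀ = 0 := by simp [hΛdef]
  simpa [h0] using h

/-- **Energy bound with a constant rate:** if along every admissible trajectory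
`d/dt E ≤ 2 λ E` on `[t₀, t₁)`, then `G(t₁; t₀) ≤ exp(2 λ (t₁ − t₀))`. [folklore] -/
theorem optimalAmplification_le_exp_const {e' : (ℝ → X) → ℝ → ℝ} {l : ℝ} (ht : t₀ ≤ t₁)
    (he : ∀ V, IsSol V → ContinuousOn (fun t => E t (V t)) (Icc t₀ t₁))
    (he' : ∀ V, IsSol V → ∀ t ∈ Ico t₀ t₁, HasDerivWithinAt (fun s => E s (V s)) (e' V t) (Ici t) t)
    (bound : ∀ V, IsSol V → ∀ t ∈ Ico t₀ t₁, e' V t ≤ 2 * l * E t (V t)) :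
    optimalAmplification IsSol E t₀ t₁ ≤ ENNReal.ofReal (Real.exp (2 * (l * (t₁ - t₀)))) := by
  have h := optimalAmplification_le_exp_of_deriv_right_le (Λ := fun t => l * t) (l := fun _ => l)
    ht (continuousOn_const.mul continuousOn_id)
    (fun t _ => by simpa using (hasDerivWithinAt_id t (Ici t)).const_mul l) he he' bound
  simpa [mul_sub] using h

end Literature.Analysis.FluidPDE

end
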